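import Literature.Analysis.FluidPDE.GaussianVortexFlatNash
import Literature.Analysis.FluidPDE.GaussianVortexFormDomainConstants
import Mathlib.Analysis.InnerProductSpace.LaxMilgram
import HarnessLib

/-!
# The drift-perturbed resolvent `(κ − L_λ + v·∇)⁻¹` on the form domain `H¹(μ_λ)`

Analysis/FluidPDE definitions file, the linear step of the Leray–Schauder (Schauder) existence
proof behind the named fact `GallayMaekawa2016_thm41` (Gallay–Maekawa 2016, Thm. 4.1: asymmetric
Burgers vortices for every `λ ∈ [0,1)` and every circulation `α`; M2 = Maekawa, M3AS 2009,
"Leray–Schauder fixed point theorem"). For a bounded measurable velocity field `v` on `ℝ²`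
(`‖v‖ ≤ V`) and `κ > V²/2 + ½` we solve, in the ground-state variables `w = ρ_λ u`,
`U = (u, G) ∈ H = H¹(μ_λ)` (`GaussianVortexFormDomain`), the weak resolvent problem

  `a_κ(U, Φ) := κ⟪u, φ⟫_{L²(μ)} + ⟪G, G_φ⟫_{L²(μ)} − ⟪u v, G_φ⟫_{L²(μ)} = κ ⟪ũ, φ⟫_{L²(μ)}`  for all
  `Φ = (φ, G_φ) ∈ H`,

the flat pairing of `(κ − L_λ + v·∇) w = κ w̃` with `φ` (`w̃ = ρ_λ ũ`). Definitions:

* `fieldMulL hvm hv : L²(μ_λ) →L L²(μ_λ; ℝ²)`, `u ↦ u v`;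
* `driftForm lam hvm hv κ : H →L H →L ℝ`, the bilinear form `a_κ`;
* `driftRhs lam κ ũ : H →L ℝ`, `Φ ↦ κ⟪ũ, φ⟫`;
* `driftSolve lam hvm hv hκ ũ : H`, the Lax–Milgram solution.

Theorems (all proved): `a_κ` is coercive with constant `½` for `κ ≥ V²/2 + ½`
(`driftForm_self_ge`); the weak equation and uniqueness (`driftSolve_spec`, `driftSolve_unique`);
`‖U‖ ≤ 2κ‖ũ‖`; **mass conservation** `∫ u dμ_λ = ∫ ũ dμ_λ` (test `Φ = (1,0)`); the **weak
maximum principle** `ũ ≥ 0 ⟹ u ≥ 0` (test `Φ = U⁻`, `GaussianVortexFormDomainTrunc`); and the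
**Lipschitz dependence on the data** `‖U₁ − U₂‖ ≤ 2κ‖ũ₁ − ũ₂‖ + 2 sup‖v₁ − v₂‖ ‖u₂‖`.

## References

* Th. Gallay, Y. Maekawa, *Existence and stability of viscous vortices*, arXiv:1610.08384, §4.1,
  Thm. 4.1. [GallayMaekawa2016]
* D. Gilbarg, N. S. Trudinger, *Elliptic Partial Differential Equations of Second Order*,
  Springer (2001), Thm. 5.8 (Lax–Milgram), Thm. 8.1 (weak maximum principle), Thm. 11.3
  (Leray–Schauder). [GilbargTrudinger2001]
-/

open MeasureTheory Filter Set WithLp Metric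
open scoped Real RealInnerProductSpace Topology InnerProductSpace ContDiff

noncomputable section

namespace Literature.Analysis.FluidPDE

open Literature.Analysis.UnboundedOperators

/-! ### Multiplication by a bounded vector field `u ↦ u v` -/

section FieldMul

variable {lam : ℝ}
variable {v : EuclideanSpace ℝ (Fin 2) → EuclideanSpace ℝ (Fin 2)} (hvm : Measurable v) {V : ℝ}
  (hv : ∀ x, ‖v x‖ ≤ V)
include hvm hv

/-- `u v ∈ L²(μ_λ; ℝ²)` for `u ∈ L²(μ_λ)` and bounded measurable `v`. [folklore] -/
theorem memLp_smul_field (u : Lp ℝ 2 (gaussLamMeasure lam)) :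
    MemLp (fun x => (u : EuclideanSpace ℝ (Fin 2) → ℝ) x • v x) 2 (gaussLamMeasure lam) := by
  refine MemLp.of_le_mul (c := V) (Lp.memLp u)
    ((Lp.aestronglyMeasurable u).smul hvm.stronglyMeasurable.aestronglyMeasurable)
    (Eventually.of_forall fun x => ?_)
  rw [norm_smul, mul_comm]
  exact mul_le_mul_of_nonneg_right (hv x) (norm_nonneg _)

omit hvm hv in
/-- The bound `V` of a bounded field is non-negative (the plane is nonempty). [folklore] -/
theorem fieldBound_nonneg (hv : ∀ x, ‖v x‖ ≤ V) : 0 ≤ V := (norm_nonneg _).trans (hv 0)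

/-- **The multiplier `u ↦ u v` as a bounded operator `L²(μ_λ) → L²(μ_λ; ℝ²)`**, norm `≤ V`.
[folklore] -/
def fieldMulL : Lp ℝ 2 (gaussLamMeasure lam) →L[ℝ] Lp (EuclideanSpace ℝ (Fin 2)) 2 (gaussLamMeasure lam) :=
  LinearMap.mkContinuous
    { toFun := fun u => MemLp.toLp (fun x => (u : EuclideanSpace ℝ (Fin 2) → ℝ) x • v x)
        (memLp_smul_field hvm hv u)
      map_add' := fun u u' => by
        refine Lp.ext ?_
        filter_upwards [MemLp.coeFn_toLp (memLp_smul_field hvm hv (u + u')),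
          Lp.coeFn_add ((memLp_smul_field hvm hv u).toLp _) ((memLp_smul_field hvm hv u').toLp _),
          MemLp.coeFn_toLp (memLp_smul_field hvm hv u), MemLp.coeFn_toLp (memLp_smul_field hvm hv u'),
          Lp.coeFn_add u u'] with x h1 h2 h3 h4 h5
        rw [h1, h2, Pi.add_apply, h3, h4, h5, Pi.add_apply, add_smul]
      map_smul' := fun c u => by
        refine Lp.ext ?_
        filter_upwards [MemLp.coeFn_toLp (memLp_smul_field hvm hv (c • u)),
          Lp.coeFn_smul c ((memLp_smul_field hvm hv u).toLp _),
          MemLp.coeFn_toLp (memLp_smul_field hvm hv u), Lp.coeFn_smul c u] with x h1 h2 h3 h4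
        rw [h1, RingHom.id_apply, h2, Pi.smul_apply, h3, h4, Pi.smul_apply, smul_eq_mul, smul_smul] }
    V fun u => by
      refine Lp.norm_le_mul_norm_of_ae_le_mul ?_
      filter_upwards [MemLp.coeFn_toLp (memLp_smul_field hvm hv u)] with x hx
      simp only [LinearMap.coe_mk, AddHom.coe_mk]
      rw [hx, norm_smul, mul_comm]
      exact mul_le_mul_of_nonneg_right (hv x) (norm_nonneg _)

/-- A.e. formula: `(fieldMulL u)(x) = u(x) v(x)`. [folklore] -/
theorem fieldMulL_ae (u : Lp ℝ 2 (gaussLamMeasure lam)) :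
    ((fieldMulL hvm hv u : Lp (EuclideanSpace ℝ (Fin 2)) 2 (gaussLamMeasure lam)) :
        EuclideanSpace ℝ (Fin 2) → EuclideanSpace ℝ (Fin 2)) =ᵐ[gaussLamMeasure lam]
      fun x => (u : EuclideanSpace ℝ (Fin 2) → ℝ) x • v x := by
  have h : fieldMulL hvm hv u = MemLp.toLp (fun x => (u : EuclideanSpace ℝ (Fin 2) → ℝ) x • v x)
      (memLp_smul_field hvm hv u) := rfl
  rw [h]
  exact MemLp.coeFn_toLp _

/-- `‖u v‖ ≤ V ‖u‖`. [folklore] -/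
theorem norm_fieldMulL_le (u : Lp ℝ 2 (gaussLamMeasure lam)) : ‖fieldMulL hvm hv u‖ ≤ V * ‖u‖ := by
  refine Lp.norm_le_mul_norm_of_ae_le_mul ?_
  filter_upwards [fieldMulL_ae hvm hv u] with x hx
  rw [hx, norm_smul, mul_comm]
  exact mul_le_mul_of_nonneg_right (hv x) (norm_nonneg _)

/-- `⟪u v, G⟫ = ∫ u ⟪v, G⟫ dμ_λ`. [folklore] -/
theorem inner_fieldMulL (u : Lp ℝ 2 (gaussLamMeasure lam))
    (G : Lp (EuclideanSpace ℝ (Fin 2)) 2 (gaussLamMeasure lam)) :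
    ⟪fieldMulL hvm hv u, G⟫ = ∫ x, (u : EuclideanSpace ℝ (Fin 2) → ℝ) x *
      ⟪v x, (G : EuclideanSpace ℝ (Fin 2) → EuclideanSpace ℝ (Fin 2)) x⟫ ∂gaussLamMeasure lam := by
  rw [L2.inner_def]
  refine integral_congr_ae ?_
  filter_upwards [fieldMulL_ae hvm hv u] with x hx
  rw [hx, inner_smul_left]
  simp

end FieldMul

/-! ### The drift form `a_κ` and its coercivity -/

section Form

variable (lam : ℝ)
variable {v : EuclideanSpace ℝ (Fin 2) → EuclideanSpace ℝ (Fin 2)} (hvm : Measurable v) {V : ℝ}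
  (hv : ∀ x, ‖v x‖ ≤ V)
include hvm hv

omit hvm hv in
variable {lam} in
/-- The norm of `H¹(μ_λ)` is the `ℓ²` norm of the two components. [folklore] -/
theorem norm_sq_formDomain (U : gaussLamFormDomain lam) :
    ‖U‖ ^ 2 = ‖(U : WithLp 2 (Lp ℝ 2 (gaussLamMeasure lam) ×
      Lp (EuclideanSpace ℝ (Fin 2)) 2 (gaussLamMeasure lam))).fst‖ ^ 2 +
      ‖(U : WithLp 2 (Lp ℝ 2 (gaussLamMeasure lam) ×
        Lp (EuclideanSpace ℝ (Fin 2)) 2 (gaussLamMeasure lam))).snd‖ ^ 2 := by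
  rw [← WithLp.prod_norm_sq_eq_of_L2]
  rfl

omit hvm hv in
variable {lam} in
/-- `‖u‖ ≤ ‖U‖` and `‖G‖ ≤ ‖U‖`. [folklore] -/
theorem norm_fst_le_and_norm_snd_le_formDomain (U : gaussLamFormDomain lam) :
    ‖(U : WithLp 2 (Lp ℝ 2 (gaussLamMeasure lam) ×
      Lp (EuclideanSpace ℝ (Fin 2)) 2 (gaussLamMeasure lam))).fst‖ ≤ ‖U‖ ∧
      ‖(U : WithLp 2 (Lp ℝ 2 (gaussLamMeasure lam) ×
        Lp (EuclideanSpace ℝ (Fin 2)) 2 (gaussLamMeasure lam))).snd‖ ≤ ‖U‖ := by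
  have h := norm_sq_formDomain U
  constructor
  · nlinarith [norm_nonneg U, norm_nonneg (U : WithLp 2 (Lp ℝ 2 (gaussLamMeasure lam) ×
      Lp (EuclideanSpace ℝ (Fin 2)) 2 (gaussLamMeasure lam))).fst,
      sq_nonneg ‖(U : WithLp 2 (Lp ℝ 2 (gaussLamMeasure lam) ×
        Lp (EuclideanSpace ℝ (Fin 2)) 2 (gaussLamMeasure lam))).snd‖]
  · nlinarith [norm_nonneg U, norm_nonneg (U : WithLp 2 (Lp ℝ 2 (gaussLamMeasure lam) ×
      Lp (EuclideanSpace ℝ (Fin 2)) 2 (gaussLamMeasure lam))).snd,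
      sq_nonneg ‖(U : WithLp 2 (Lp ℝ 2 (gaussLamMeasure lam) ×
        Lp (EuclideanSpace ℝ (Fin 2)) 2 (gaussLamMeasure lam))).fst‖]

omit hvm hv in
/-- The first projection `H¹(μ_λ) → L²(μ_λ)` as a continuous linear map. [folklore] -/
def formDomainFstL : gaussLamFormDomain lam →L[ℝ] Lp ℝ 2 (gaussLamMeasure lam) :=
  (WithLp.fstL 2 ℝ (Lp ℝ 2 (gaussLamMeasure lam)) (Lp (EuclideanSpace ℝ (Fin 2)) 2 (gaussLamMeasure lam))).comp
    (gaussLamFormDomain lam).subtypeL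

omit hvm hv in
/-- The second projection `H¹(μ_λ) → L²(μ_λ; ℝ²)` as a continuous linear map. [folklore] -/
def formDomainSndL : gaussLamFormDomain lam →L[ℝ] Lp (EuclideanSpace ℝ (Fin 2)) 2 (gaussLamMeasure lam) :=
  (WithLp.sndL 2 ℝ (Lp ℝ 2 (gaussLamMeasure lam)) (Lp (EuclideanSpace ℝ (Fin 2)) 2 (gaussLamMeasure lam))).comp
    (gaussLamFormDomain lam).subtypeL

omit hvm hv in
/-- Values of the first projection. [folklore] -/
@[simp] theorem formDomainFstL_apply (U : gaussLamFormDomain lam) :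
    formDomainFstL lam U = (U : WithLp 2 (Lp ℝ 2 (gaussLamMeasure lam) ×
      Lp (EuclideanSpace ℝ (Fin 2)) 2 (gaussLamMeasure lam))).fst := rfl

omit hvm hv in
/-- Values of the second projection. [folklore] -/
@[simp] theorem formDomainSndL_apply (U : gaussLamFormDomain lam) :
    formDomainSndL lam U = (U : WithLp 2 (Lp ℝ 2 (gaussLamMeasure lam) ×
      Lp (EuclideanSpace ℝ (Fin 2)) 2 (gaussLamMeasure lam))).snd := rfl

/-- **The drift form** `a_κ(U, Φ) = κ⟪u, φ⟫ + ⟪G, G_φ⟫ − ⟪u v, G_φ⟫` on `H¹(μ_λ)` — the weak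
(flat) form of `(κ − L_λ + v·∇)(ρ_λ u)` tested against `φ`, `v` a bounded measurable velocity
field — as a continuous bilinear form. [cite: GilbargTrudinger2001, Thm. 5.8] -/
def driftForm (κ : ℝ) : gaussLamFormDomain lam →L[ℝ] gaussLamFormDomain lam →L[ℝ] ℝ :=
  κ • (innerSL ℝ (E := Lp ℝ 2 (gaussLamMeasure lam))).bilinearComp (formDomainFstL lam) (formDomainFstL lam) +
    (innerSL ℝ (E := Lp (EuclideanSpace ℝ (Fin 2)) 2 (gaussLamMeasure lam))).bilinearComp
      (formDomainSndL lam) (formDomainSndL lam) -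
    (innerSL ℝ (E := Lp (EuclideanSpace ℝ (Fin 2)) 2 (gaussLamMeasure lam))).bilinearComp
      ((fieldMulL hvm hv).comp (formDomainFstL lam)) (formDomainSndL lam)

/-- Values of the drift form. [folklore] -/
theorem driftForm_apply (κ : ℝ) (U Φ : gaussLamFormDomain lam) :
    driftForm lam hvm hv κ U Φ =
      κ * ⟪(U : WithLp 2 (Lp ℝ 2 (gaussLamMeasure lam) × Lp (EuclideanSpace ℝ (Fin 2)) 2 (gaussLamMeasure lam))).fst,
        (Φ : WithLp 2 (Lp ℝ 2 (gaussLamMeasure lam) × Lp (EuclideanSpace ℝ (Fin 2)) 2 (gaussLamMeasure lam))).fst⟫ +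
      ⟪(U : WithLp 2 (Lp ℝ 2 (gaussLamMeasure lam) × Lp (EuclideanSpace ℝ (Fin 2)) 2 (gaussLamMeasure lam))).snd,
        (Φ : WithLp 2 (Lp ℝ 2 (gaussLamMeasure lam) × Lp (EuclideanSpace ℝ (Fin 2)) 2 (gaussLamMeasure lam))).snd⟫ -
      ⟪fieldMulL hvm hv (U : WithLp 2 (Lp ℝ 2 (gaussLamMeasure lam) ×
          Lp (EuclideanSpace ℝ (Fin 2)) 2 (gaussLamMeasure lam))).fst,
        (Φ : WithLp 2 (Lp ℝ 2 (gaussLamMeasure lam) × Lp (EuclideanSpace ℝ (Fin 2)) 2 (gaussLamMeasure lam))).snd⟫ := by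
  simp only [driftForm, sub_apply, add_apply,
    FunLike.coe_smul, Pi.smul_apply, ContinuousLinearMap.bilinearComp_apply,
    innerSL_apply_apply, ContinuousLinearMap.coe_comp, Function.comp_apply, formDomainFstL_apply,
    formDomainSndL_apply, smul_eq_mul]

/-- **Coercivity of the drift form**: for `κ ≥ V²/2 + ½`, `a_κ(U, U) ≥ ½ ‖U‖²`
(`|⟪uv, G⟫| ≤ V‖u‖‖G‖ ≤ ½‖G‖² + (V²/2)‖u‖²`). [folklore] -/
theorem driftForm_self_ge {κ : ℝ} (hκ : V ^ 2 / 2 + 1 / 2 ≤ κ) (U : gaussLamFormDomain lam) :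
    1 / 2 * ‖U‖ ^ 2 ≤ driftForm lam hvm hv κ U U := by
  rw [driftForm_apply, real_inner_self_eq_norm_sq, real_inner_self_eq_norm_sq, norm_sq_formDomain]
  set u := (U : WithLp 2 (Lp ℝ 2 (gaussLamMeasure lam) × Lp (EuclideanSpace ℝ (Fin 2)) 2 (gaussLamMeasure lam))).fst
  set G := (U : WithLp 2 (Lp ℝ 2 (gaussLamMeasure lam) × Lp (EuclideanSpace ℝ (Fin 2)) 2 (gaussLamMeasure lam))).snd
  have hT : |⟪fieldMulL hvm hv u, G⟫| ≤ V * ‖u‖ * ‖G‖ :=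
    (abs_real_inner_le_norm _ _).trans (mul_le_mul_of_nonneg_right (norm_fieldMulL_le hvm hv u) (norm_nonneg _))
  have hV0 := fieldBound_nonneg hv
  have h1 : ⟪fieldMulL hvm hv u, G⟫ ≤ V * ‖u‖ * ‖G‖ := (le_abs_self _).trans hT
  nlinarith [sq_nonneg (V * ‖u‖ - ‖G‖), norm_nonneg u, norm_nonneg G, sq_nonneg ‖u‖]

/-- The drift form is coercive for `κ ≥ V²/2 + ½`. [folklore] -/
theorem isCoercive_driftForm {κ : ℝ} (hκ : V ^ 2 / 2 + 1 / 2 ≤ κ) :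
    IsCoercive (driftForm lam hvm hv κ) :=
  ⟨1 / 2, by norm_num, fun U => by rw [mul_assoc, ← sq]; exact driftForm_self_ge lam hvm hv hκ U⟩

omit hvm hv in
/-- The right-hand side `Φ ↦ κ⟪ũ, φ⟫`. [folklore] -/
def driftRhs (κ : ℝ) (ut : Lp ℝ 2 (gaussLamMeasure lam)) : gaussLamFormDomain lam →L[ℝ] ℝ :=
  κ • (innerSL ℝ ut).comp (formDomainFstL lam)

omit hvm hv in
/-- Values of the right-hand side. [folklore] -/
theorem driftRhs_apply (κ : ℝ) (ut : Lp ℝ 2 (gaussLamMeasure lam)) (Φ : gaussLamFormDomain lam) :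
    driftRhs lam κ ut Φ = κ * ⟪ut, (Φ : WithLp 2 (Lp ℝ 2 (gaussLamMeasure lam) ×
      Lp (EuclideanSpace ℝ (Fin 2)) 2 (gaussLamMeasure lam))).fst⟫ := rfl

omit hvm hv in
/-- `‖Φ ↦ κ⟪ũ, φ⟫‖ ≤ |κ| ‖ũ‖`. [folklore] -/
theorem norm_driftRhs_le (κ : ℝ) (ut : Lp ℝ 2 (gaussLamMeasure lam)) : ‖driftRhs lam κ ut‖ ≤ |κ| * ‖ut‖ := by
  refine ContinuousLinearMap.opNorm_le_bound _ (by positivity) fun Φ => ?_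
  rw [driftRhs_apply, norm_mul, Real.norm_eq_abs, mul_assoc]
  refine mul_le_mul_of_nonneg_left ((norm_inner_le_norm _ _).trans
    (mul_le_mul_of_nonneg_left (norm_fst_le_and_norm_snd_le_formDomain Φ).1 (norm_nonneg _))) (abs_nonneg _)

/-! ### The Lax–Milgram solution -/

/-- **The solution operator `ũ ↦ U = (u, G)` of the weak resolvent problem
`a_κ(U, Φ) = κ⟪ũ, φ⟫` (`Φ ∈ H¹(μ_λ)`)**, `κ ≥ V²/2 + ½`: Mathlib's Lax–Milgram equivalence of the
coercive drift form applied to the Riesz representative of the right-hand side; `w = ρ_λ u` is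
the weak solution of `(κ − L_λ + v·∇) w = κ ρ_λ ũ` in `L²(ρ_λ⁻¹)`. [cite: GilbargTrudinger2001, Thm. 5.8] -/
def driftSolve {κ : ℝ} (hκ : V ^ 2 / 2 + 1 / 2 ≤ κ) (ut : Lp ℝ 2 (gaussLamMeasure lam)) :
    gaussLamFormDomain lam :=
  (isCoercive_driftForm lam hvm hv hκ).continuousLinearEquivOfBilin.symm
    ((InnerProductSpace.toDual ℝ (gaussLamFormDomain lam)).symm (driftRhs lam κ ut))

/-- **The weak resolvent equation**: `a_κ(U, Φ) = κ⟪ũ, φ⟫` for `U = driftSolve ũ` and every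
`Φ ∈ H¹(μ_λ)`. [folklore] -/
theorem driftSolve_spec {κ : ℝ} (hκ : V ^ 2 / 2 + 1 / 2 ≤ κ) (ut : Lp ℝ 2 (gaussLamMeasure lam))
    (Φ : gaussLamFormDomain lam) :
    driftForm lam hvm hv κ (driftSolve lam hvm hv hκ ut) Φ = κ * ⟪ut, (Φ : WithLp 2 (Lp ℝ 2 (gaussLamMeasure lam) ×
      Lp (EuclideanSpace ℝ (Fin 2)) 2 (gaussLamMeasure lam))).fst⟫ := by
  rw [← driftRhs_apply lam, ← (isCoercive_driftForm lam hvm hv hκ).continuousLinearEquivOfBilin_apply,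
    driftSolve, ContinuousLinearEquiv.apply_symm_apply]
  exact InnerProductSpace.toDual_symm_apply

/-- **Uniqueness**: any `U' ∈ H¹(μ_λ)` satisfying the weak resolvent equation is `driftSolve ũ`
(coercivity). [folklore] -/
theorem driftSolve_unique {κ : ℝ} (hκ : V ^ 2 / 2 + 1 / 2 ≤ κ) (ut : Lp ℝ 2 (gaussLamMeasure lam))
    {U' : gaussLamFormDomain lam}
    (hU' : ∀ Φ : gaussLamFormDomain lam, driftForm lam hvm hv κ U' Φ = κ * ⟪ut, (Φ : WithLp 2 (Lp ℝ 2 (gaussLamMeasure lam) ×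
      Lp (EuclideanSpace ℝ (Fin 2)) 2 (gaussLamMeasure lam))).fst⟫) :
    U' = driftSolve lam hvm hv hκ ut := by
  set D := U' - driftSolve lam hvm hv hκ ut with hD
  have h0 : driftForm lam hvm hv κ D D = 0 := by
    rw [hD, ContinuousLinearMap.map_sub₂, hU', driftSolve_spec, sub_self]
  have hc := driftForm_self_ge lam hvm hv hκ D
  rw [h0] at hc
  have : ‖D‖ = 0 := by nlinarith [norm_nonneg D]
  exact sub_eq_zero.1 (norm_eq_zero.1 this)

/-- **Boundedness of the solution operator**: `‖U‖ ≤ 2κ ‖ũ‖`. [folklore] -/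
theorem norm_driftSolve_le {κ : ℝ} (hκ : V ^ 2 / 2 + 1 / 2 ≤ κ) (ut : Lp ℝ 2 (gaussLamMeasure lam)) :
    ‖driftSolve lam hvm hv hκ ut‖ ≤ 2 * κ * ‖ut‖ := by
  have hκ0 : 0 ≤ κ := by nlinarith [sq_nonneg V]
  set U := driftSolve lam hvm hv hκ ut with hU
  have hspec := driftSolve_spec lam hvm hv hκ ut U
  have hcoer := driftForm_self_ge lam hvm hv hκ U
  have hCS : κ * ⟪ut, (U : WithLp 2 (Lp ℝ 2 (gaussLamMeasure lam) × Lp (EuclideanSpace ℝ (Fin 2)) 2 (gaussLamMeasure lam))).fst⟫ ≤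
      κ * (‖ut‖ * ‖U‖) :=
    mul_le_mul_of_nonneg_left ((le_abs_self _).trans ((abs_real_inner_le_norm _ _).trans
      (mul_le_mul_of_nonneg_left (norm_fst_le_and_norm_snd_le_formDomain U).1 (norm_nonneg _)))) hκ0
  have h1 : 1 / 2 * ‖U‖ ^ 2 ≤ κ * (‖ut‖ * ‖U‖) := hcoer.trans (hspec.le.trans hCS)
  by_cases h0 : ‖U‖ = 0
  · rw [h0]; positivity
  · have hpos : 0 < ‖U‖ := lt_of_le_of_ne (norm_nonneg _) (Ne.symm h0)
    nlinarith

/-! ### Mass conservation and the weak maximum principle -/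

/-- **Mass conservation**: `∫ u dμ_λ = ∫ ũ dμ_λ`, i.e. `∫ w dx = ∫ w̃ dx` — test the weak equation
with `Φ = (1, 0) ∈ H¹(μ_λ)` (`one_mem_gaussLamFormDomain`), for which the gradient and the
transport terms vanish. [folklore] -/
theorem inner_gaussLamOne_driftSolve (hlam : lam ∈ Set.Ico (0 : ℝ) 1) {κ : ℝ} (hκ : V ^ 2 / 2 + 1 / 2 ≤ κ)
    (ut : Lp ℝ 2 (gaussLamMeasure lam)) :
    ⟪gaussLamOne hlam, ((driftSolve lam hvm hv hκ ut : gaussLamFormDomain lam) : WithLp 2 (Lp ℝ 2 (gaussLamMeasure lam) ×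
      Lp (EuclideanSpace ℝ (Fin 2)) 2 (gaussLamMeasure lam))).fst⟫ = ⟪gaussLamOne hlam, ut⟫ := by
  have hκ0 : 0 < κ := by nlinarith [sq_nonneg V]
  set One : gaussLamFormDomain lam := ⟨toLp 2 (gaussLamOne hlam, 0), one_mem_gaussLamFormDomain hlam⟩ with hOne
  have h := driftSolve_spec lam hvm hv hκ ut One
  rw [driftForm_apply] at h
  have hfst : ((One : gaussLamFormDomain lam) : WithLp 2 (Lp ℝ 2 (gaussLamMeasure lam) ×
      Lp (EuclideanSpace ℝ (Fin 2)) 2 (gaussLamMeasure lam))).fst = gaussLamOne hlam := rfl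
  have hsnd : ((One : gaussLamFormDomain lam) : WithLp 2 (Lp ℝ 2 (gaussLamMeasure lam) ×
      Lp (EuclideanSpace ℝ (Fin 2)) 2 (gaussLamMeasure lam))).snd = 0 := rfl
  rw [hfst, hsnd, inner_zero_right, inner_zero_right, add_zero, sub_zero] at h
  have h2 := mul_left_cancel₀ hκ0.ne' h
  rw [real_inner_comm] at h2
  rw [h2, real_inner_comm]

/-- **The weak maximum principle** for `κ − L_λ + v·∇` in the weighted form: if `ũ ≥ 0` a.e. then
the solution `u ≥ 0` a.e. Proof (Stampacchia): with `U⁻ = (u⁻, −1_{u<0}G) ∈ H¹(μ_λ)`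
(`negPart_mem_gaussLamFormDomain`) one has `a_κ(U, U⁻) = −a_κ(U⁻, U⁻) ≤ −½‖U⁻‖²` pointwise
(`u u⁻ = −(u⁻)²`, `⟪G, G⁻⟫ = −‖G⁻‖²`, `u⟪v, G⁻⟫ = −u⁻⟪v, G⁻⟫`), while
`a_κ(U, U⁻) = κ⟪ũ, u⁻⟫ ≥ 0`. [cite: GilbargTrudinger2001, Thm. 8.1] -/
theorem driftSolve_nonneg {κ : ℝ} (hκ : V ^ 2 / 2 + 1 / 2 ≤ κ) {ut : Lp ℝ 2 (gaussLamMeasure lam)}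
    (hut : 0 ≤ᵐ[gaussLamMeasure lam] (ut : EuclideanSpace ℝ (Fin 2) → ℝ)) :
    0 ≤ᵐ[gaussLamMeasure lam] (((driftSolve lam hvm hv hκ ut : gaussLamFormDomain lam) : WithLp 2 (Lp ℝ 2 (gaussLamMeasure lam) ×
      Lp (EuclideanSpace ℝ (Fin 2)) 2 (gaussLamMeasure lam))).fst : EuclideanSpace ℝ (Fin 2) → ℝ) := by
  have hκ0 : 0 ≤ κ := by nlinarith [sq_nonneg V]
  set U : gaussLamFormDomain lam := driftSolve lam hvm hv hκ ut with hUdef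
  set Uv : WithLp 2 (Lp ℝ 2 (gaussLamMeasure lam) × Lp (EuclideanSpace ℝ (Fin 2)) 2 (gaussLamMeasure lam)) :=
    ((U : gaussLamFormDomain lam) : WithLp 2 (Lp ℝ 2 (gaussLamMeasure lam) × Lp (EuclideanSpace ℝ (Fin 2)) 2 (gaussLamMeasure lam)))
    with hUv
  set u : Lp ℝ 2 (gaussLamMeasure lam) := Uv.fst with hu
  set G : Lp (EuclideanSpace ℝ (Fin 2)) 2 (gaussLamMeasure lam) := Uv.snd with hG
  -- the negative part as an element of `H`
  have hmem := negPart_mem_gaussLamFormDomain (lam := lam) U.2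
  set um : Lp ℝ 2 (gaussLamMeasure lam) := Lp.negPart u with hum
  set Gm : Lp (EuclideanSpace ℝ (Fin 2)) 2 (gaussLamMeasure lam) := (memLp_negPartGrad u G).toLp _ with hGm
  set Um : gaussLamFormDomain lam := ⟨toLp 2 (um, Gm), hmem⟩ with hUm
  have hUm_fst : ((Um : gaussLamFormDomain lam) : WithLp 2 (Lp ℝ 2 (gaussLamMeasure lam) ×
      Lp (EuclideanSpace ℝ (Fin 2)) 2 (gaussLamMeasure lam))).fst = um := rfl
  have hUm_snd : ((Um : gaussLamFormDomain lam) : WithLp 2 (Lp ℝ 2 (gaussLamMeasure lam) ×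
      Lp (EuclideanSpace ℝ (Fin 2)) 2 (gaussLamMeasure lam))).snd = Gm := rfl
  have hum_ae : (um : EuclideanSpace ℝ (Fin 2) → ℝ) =ᵐ[gaussLamMeasure lam] fun x =>
      max (-(u : EuclideanSpace ℝ (Fin 2) → ℝ) x) 0 := Lp.coeFn_negPart_eq_max u
  have hGm_ae := MemLp.coeFn_toLp (memLp_negPartGrad u G)
  -- the three pointwise identities, integrated
  have e1 : ⟪u, um⟫ = -‖um‖ ^ 2 := by
    rw [← real_inner_self_eq_norm_sq, L2.inner_def, L2.inner_def, ← integral_neg]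
    refine integral_congr_ae ?_
    filter_upwards [hum_ae] with x hx
    simp only [RCLike.inner_apply, conj_trivial, hx]
    have := mul_negPart_eq ((u : EuclideanSpace ℝ (Fin 2) → ℝ) x)
    nlinarith [this]
  have e2 : ⟪G, Gm⟫ = -‖Gm‖ ^ 2 := by
    rw [← real_inner_self_eq_norm_sq, L2.inner_def, L2.inner_def, ← integral_neg]
    refine integral_congr_ae ?_
    filter_upwards [hGm_ae] with x hx
    rw [hx, real_inner_self_eq_norm_sq]
    exact inner_negPartGrad_eq _ _
  have e3 : ⟪fieldMulL hvm hv u, Gm⟫ = -⟪fieldMulL hvm hv um, Gm⟫ := by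
    rw [inner_fieldMulL, inner_fieldMulL, ← integral_neg]
    refine integral_congr_ae ?_
    filter_upwards [hum_ae, hGm_ae] with x hx hx'
    rw [hx, hx']
    have h := smul_negPartGrad_eq ((u : EuclideanSpace ℝ (Fin 2) → ℝ) x)
      ((G : EuclideanSpace ℝ (Fin 2) → EuclideanSpace ℝ (Fin 2)) x)
    -- take the inner product with `v x` of the vector identity
    have h2 := congrArg (fun z => ⟪v x, z⟫) h
    simp only [inner_smul_right, neg_mul] at h2 ⊢
    linarith [h2]
  -- `a(U, U⁻) = -a(U⁻, U⁻)`
  have hanti : driftForm lam hvm hv κ U Um = -driftForm lam hvm hv κ Um Um := by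
    rw [driftForm_apply, driftForm_apply, hUm_fst, hUm_snd, ← hUv, ← hu, ← hG, e1, e2, e3,
      real_inner_self_eq_norm_sq, real_inner_self_eq_norm_sq]
    ring
  -- `a(U, U⁻) = κ⟪ũ, u⁻⟫ ≥ 0`
  have hpos : 0 ≤ driftForm lam hvm hv κ U Um := by
    rw [hUdef, driftSolve_spec, hUm_fst]
    refine mul_nonneg hκ0 ?_
    rw [L2.inner_def]
    refine integral_nonneg_of_ae ?_
    filter_upwards [hut, hum_ae] with x hx hx'
    simp only [RCLike.inner_apply, conj_trivial, hx', Pi.zero_apply]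
    exact mul_nonneg (le_max_right _ _) hx
  have hcoer := driftForm_self_ge lam hvm hv hκ Um
  have hUm0 : ‖Um‖ = 0 := by nlinarith [norm_nonneg Um]
  have hum0 : um = 0 := by
    have h := (norm_fst_le_and_norm_snd_le_formDomain Um).1
    rw [hUm_fst, hUm0] at h
    exact norm_eq_zero.1 (le_antisymm h (norm_nonneg _))
  have hum0_ae : (um : EuclideanSpace ℝ (Fin 2) → ℝ) =ᵐ[gaussLamMeasure lam] 0 := by
    rw [hum0]; exact Lp.coeFn_zero ℝ 2 (gaussLamMeasure lam)
  filter_upwards [hum_ae, hum0_ae] with x hx hx0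
  rw [hx0, Pi.zero_apply] at hx
  have : max (-(u : EuclideanSpace ℝ (Fin 2) → ℝ) x) 0 = 0 := hx.symm
  have h2 := le_max_left (-(u : EuclideanSpace ℝ (Fin 2) → ℝ) x) 0
  rw [this] at h2
  simp only [Pi.zero_apply]
  linarith

/-! ### Lipschitz dependence on the data `(ũ, v)` -/

/-- **Difference of two solutions**: for two velocity fields `v₁, v₂` (bounds `V`) and data
`ũ₁, ũ₂`, the solutions `Uᵢ` of `a_κ^{vᵢ}(Uᵢ, ·) = κ⟪ũᵢ, ·⟫` satisfy
`‖U₁ − U₂‖ ≤ 2κ ‖ũ₁ − ũ₂‖ + 2 W ‖u₂‖` whenever `‖v₁ − v₂‖ ≤ W` pointwise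
(coercivity of `a_κ^{v₁}` applied to `U₁ − U₂`). [folklore] -/
theorem norm_driftSolve_sub_le {κ : ℝ} (hκ : V ^ 2 / 2 + 1 / 2 ≤ κ)
    {v₂ : EuclideanSpace ℝ (Fin 2) → EuclideanSpace ℝ (Fin 2)} (hvm₂ : Measurable v₂) (hv₂ : ∀ x, ‖v₂ x‖ ≤ V)
    {W : ℝ} (hW : ∀ x, ‖v x - v₂ x‖ ≤ W) (ut₁ ut₂ : Lp ℝ 2 (gaussLamMeasure lam)) :
    ‖driftSolve lam hvm hv hκ ut₁ - driftSolve lam hvm₂ hv₂ hκ ut₂‖ ≤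
      2 * κ * ‖ut₁ - ut₂‖ + 2 * W * ‖((driftSolve lam hvm₂ hv₂ hκ ut₂ : gaussLamFormDomain lam) : WithLp 2 (Lp ℝ 2 (gaussLamMeasure lam) ×
        Lp (EuclideanSpace ℝ (Fin 2)) 2 (gaussLamMeasure lam))).fst‖ := by
  have hκ0 : 0 ≤ κ := by nlinarith [sq_nonneg V]
  have hW0 : 0 ≤ W := (norm_nonneg _).trans (hW 0)
  -- the two forms differ only in the transport term
  have hdiff : ∀ U Φ : gaussLamFormDomain lam, driftForm lam hvm hv κ U Φ =
      driftForm lam hvm₂ hv₂ κ U Φ - ⟪fieldMulL hvm hv (U : WithLp 2 (Lp ℝ 2 (gaussLamMeasure lam) ×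
          Lp (EuclideanSpace ℝ (Fin 2)) 2 (gaussLamMeasure lam))).fst -
        fieldMulL hvm₂ hv₂ (U : WithLp 2 (Lp ℝ 2 (gaussLamMeasure lam) ×
          Lp (EuclideanSpace ℝ (Fin 2)) 2 (gaussLamMeasure lam))).fst,
        (Φ : WithLp 2 (Lp ℝ 2 (gaussLamMeasure lam) × Lp (EuclideanSpace ℝ (Fin 2)) 2 (gaussLamMeasure lam))).snd⟫ := by
    intro U Φ
    rw [driftForm_apply, driftForm_apply, inner_sub_left]
    ring
  -- the multiplier difference is small: `‖(v₁ − v₂) u₂‖ ≤ W ‖u₂‖`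
  have hmul : ∀ u : Lp ℝ 2 (gaussLamMeasure lam), ‖fieldMulL hvm hv u - fieldMulL hvm₂ hv₂ u‖ ≤ W * ‖u‖ := by
    intro u
    refine Lp.norm_le_mul_norm_of_ae_le_mul ?_
    filter_upwards [Lp.coeFn_sub (fieldMulL hvm hv u) (fieldMulL hvm₂ hv₂ u),
      fieldMulL_ae hvm hv u, fieldMulL_ae hvm₂ hv₂ u] with x h1 h2 h3
    rw [h1, Pi.sub_apply, h2, h3, ← smul_sub, norm_smul, mul_comm]
    exact mul_le_mul_of_nonneg_right (hW x) (norm_nonneg _)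
  -- coercivity applied to the difference
  have key : ∀ D U₂ : gaussLamFormDomain lam, D = driftSolve lam hvm hv hκ ut₁ - U₂ →
      U₂ = driftSolve lam hvm₂ hv₂ hκ ut₂ →
      1 / 2 * ‖D‖ ^ 2 ≤ (κ * ‖ut₁ - ut₂‖ + W * ‖(U₂ : WithLp 2 (Lp ℝ 2 (gaussLamMeasure lam) ×
        Lp (EuclideanSpace ℝ (Fin 2)) 2 (gaussLamMeasure lam))).fst‖) * ‖D‖ := by
    intro D U₂ hD hU₂
    have hcoer := driftForm_self_ge lam hvm hv hκ D
    have hform : driftForm lam hvm hv κ D D =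
        κ * ⟪ut₁ - ut₂, (D : WithLp 2 (Lp ℝ 2 (gaussLamMeasure lam) × Lp (EuclideanSpace ℝ (Fin 2)) 2 (gaussLamMeasure lam))).fst⟫ +
          ⟪fieldMulL hvm hv (U₂ : WithLp 2 (Lp ℝ 2 (gaussLamMeasure lam) × Lp (EuclideanSpace ℝ (Fin 2)) 2 (gaussLamMeasure lam))).fst -
            fieldMulL hvm₂ hv₂ (U₂ : WithLp 2 (Lp ℝ 2 (gaussLamMeasure lam) × Lp (EuclideanSpace ℝ (Fin 2)) 2 (gaussLamMeasure lam))).fst,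
            (D : WithLp 2 (Lp ℝ 2 (gaussLamMeasure lam) × Lp (EuclideanSpace ℝ (Fin 2)) 2 (gaussLamMeasure lam))).snd⟫ := by
      have h1 : driftForm lam hvm hv κ D D =
          driftForm lam hvm hv κ (driftSolve lam hvm hv hκ ut₁ - U₂) D := by rw [← hD]
      rw [h1, ContinuousLinearMap.map_sub₂, driftSolve_spec, hdiff U₂ D, hU₂, driftSolve_spec]
      simp only [inner_sub_left]
      ring
    have hdfst := (norm_fst_le_and_norm_snd_le_formDomain D).1
    have hdsnd := (norm_fst_le_and_norm_snd_le_formDomain D).2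
    have h1 : κ * ⟪ut₁ - ut₂, (D : WithLp 2 (Lp ℝ 2 (gaussLamMeasure lam) ×
        Lp (EuclideanSpace ℝ (Fin 2)) 2 (gaussLamMeasure lam))).fst⟫ ≤ κ * (‖ut₁ - ut₂‖ * ‖D‖) :=
      mul_le_mul_of_nonneg_left ((le_abs_self _).trans ((abs_real_inner_le_norm _ _).trans
        (mul_le_mul_of_nonneg_left hdfst (norm_nonneg _)))) hκ0
    have h2 : ⟪fieldMulL hvm hv (U₂ : WithLp 2 (Lp ℝ 2 (gaussLamMeasure lam) × Lp (EuclideanSpace ℝ (Fin 2)) 2 (gaussLamMeasure lam))).fst -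
        fieldMulL hvm₂ hv₂ (U₂ : WithLp 2 (Lp ℝ 2 (gaussLamMeasure lam) × Lp (EuclideanSpace ℝ (Fin 2)) 2 (gaussLamMeasure lam))).fst,
        (D : WithLp 2 (Lp ℝ 2 (gaussLamMeasure lam) × Lp (EuclideanSpace ℝ (Fin 2)) 2 (gaussLamMeasure lam))).snd⟫ ≤
        W * ‖(U₂ : WithLp 2 (Lp ℝ 2 (gaussLamMeasure lam) × Lp (EuclideanSpace ℝ (Fin 2)) 2 (gaussLamMeasure lam))).fst‖ * ‖D‖ :=
      (le_abs_self _).trans ((abs_real_inner_le_norm _ _).trans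
        (mul_le_mul (hmul _) hdsnd (norm_nonneg _) (by positivity)))
    calc 1 / 2 * ‖D‖ ^ 2 ≤ driftForm lam hvm hv κ D D := hcoer
      _ ≤ κ * (‖ut₁ - ut₂‖ * ‖D‖) + W * ‖(U₂ : WithLp 2 (Lp ℝ 2 (gaussLamMeasure lam) ×
          Lp (EuclideanSpace ℝ (Fin 2)) 2 (gaussLamMeasure lam))).fst‖ * ‖D‖ := by
          rw [hform]; exact add_le_add h1 h2
      _ = _ := by ring
  have h3 := key (driftSolve lam hvm hv hκ ut₁ - driftSolve lam hvm₂ hv₂ hκ ut₂)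
    (driftSolve lam hvm₂ hv₂ hκ ut₂) rfl rfl
  -- `½ d² ≤ c d` gives `d ≤ 2c`
  generalize hd : ‖driftSolve lam hvm hv hκ ut₁ - driftSolve lam hvm₂ hv₂ hκ ut₂‖ = d at h3 ⊢
  generalize hn : ‖((driftSolve lam hvm₂ hv₂ hκ ut₂ : gaussLamFormDomain lam) : WithLp 2 (Lp ℝ 2 (gaussLamMeasure lam) ×
        Lp (EuclideanSpace ℝ (Fin 2)) 2 (gaussLamMeasure lam))).fst‖ = n at h3 ⊢
  have hd0 : 0 ≤ d := hd ▸ norm_nonneg _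
  have hn0 : 0 ≤ n := hn ▸ norm_nonneg _
  by_cases h0 : d = 0
  · rw [h0]; positivity
  · have hpos : 0 < d := lt_of_le_of_ne hd0 (Ne.symm h0)
    nlinarith [h3, norm_nonneg (ut₁ - ut₂)]

end Form

/-! ### A priori estimates for the resolvent: flat `L²` (transport-free) and weighted -/

section Apriori

variable {lam : ℝ} (hlam : lam ∈ Set.Ico (0 : ℝ) 1)
variable {v : EuclideanSpace ℝ (Fin 2) → EuclideanSpace ℝ (Fin 2)} (hvm : Measurable v) {V : ℝ}
  (hv : ∀ x, ‖v x‖ ≤ V)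
include hlam hvm hv

omit hvm hv in
/-- `√ρ_λ u ∈ L²(μ_λ)`. [folklore] -/
theorem memLp_sqrtWeight_mul (u : Lp ℝ 2 (gaussLamMeasure lam)) :
    MemLp (fun x : EuclideanSpace ℝ (Fin 2) =>
      Real.sqrt (Real.exp (-((1 + lam) / 4 * x 0 ^ 2 + (1 - lam) / 4 * x 1 ^ 2))) *
        (u : EuclideanSpace ℝ (Fin 2) → ℝ) x) 2 (gaussLamMeasure lam) := by
  refine MemLp.of_le_mul (c := 1) (Lp.memLp u) (((continuous_expNegQuadLam lam).sqrt).aestronglyMeasurable.mul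
    (Lp.aestronglyMeasurable u)) (Eventually.of_forall fun x => ?_)
  rw [norm_mul, one_mul, Real.norm_of_nonneg (Real.sqrt_nonneg _)]
  refine mul_le_of_le_one_left (norm_nonneg _) ?_
  rw [Real.sqrt_le_one]
  exact expNegQuadLam_le_one hlam x

omit hvm hv in
/-- **Cauchy–Schwarz for the flat pairing**: `∫ ρ ũ u dμ_λ ≤ ‖w̃‖₂ ‖w‖₂`, i.e.
`⟪ũ, (ρU)₁⟫ ≤ ⟪ũ,(ρŨ)₁⟫^{1/2} ⟪u,(ρU)₁⟫^{1/2}` (`ρ = √ρ √ρ`). [folklore] -/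
theorem inner_weight_mul_fst_le_sqrt (ut u : Lp ℝ 2 (gaussLamMeasure lam)) :
    ⟪ut, (memLp_weight_mul_fst hlam u).toLp _⟫ ≤
      Real.sqrt ⟪ut, (memLp_weight_mul_fst hlam ut).toLp _⟫ * Real.sqrt ⟪u, (memLp_weight_mul_fst hlam u).toLp _⟫ := by
  set St := (memLp_sqrtWeight_mul hlam ut).toLp _ with hSt
  set Su := (memLp_sqrtWeight_mul hlam u).toLp _ with hSu
  have hρ0 : ∀ x : EuclideanSpace ℝ (Fin 2), 0 ≤ Real.exp (-((1 + lam) / 4 * x 0 ^ 2 + (1 - lam) / 4 * x 1 ^ 2)) :=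
    fun x => (Real.exp_pos _).le
  have e1 : ⟪ut, (memLp_weight_mul_fst hlam u).toLp _⟫ = ⟪St, Su⟫ := by
    rw [inner_weight_mul_fst_eq hlam, L2.inner_def]
    refine integral_congr_ae ?_
    filter_upwards [MemLp.coeFn_toLp (memLp_sqrtWeight_mul hlam ut), MemLp.coeFn_toLp (memLp_sqrtWeight_mul hlam u)]
      with x h1 h2
    rw [hSt, hSu, h1, h2]
    simp only [RCLike.inner_apply, conj_trivial]
    have hs := Real.mul_self_sqrt (hρ0 x)
    calc _ = (Real.sqrt (Real.exp (-((1 + lam) / 4 * x 0 ^ 2 + (1 - lam) / 4 * x 1 ^ 2))) *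
          Real.sqrt (Real.exp (-((1 + lam) / 4 * x 0 ^ 2 + (1 - lam) / 4 * x 1 ^ 2)))) *
          (ut : EuclideanSpace ℝ (Fin 2) → ℝ) x * (u : EuclideanSpace ℝ (Fin 2) → ℝ) x := by rw [hs]
      _ = _ := by ring
  have e2 : ∀ w : Lp ℝ 2 (gaussLamMeasure lam), ⟪w, (memLp_weight_mul_fst hlam w).toLp _⟫ =
      ‖(memLp_sqrtWeight_mul hlam w).toLp _‖ ^ 2 := by
    intro w
    rw [inner_fst_weightMul_fst_eq hlam, norm_sq_Lp_two_eq_integral_norm_sq]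
    refine integral_congr_ae ?_
    filter_upwards [MemLp.coeFn_toLp (memLp_sqrtWeight_mul hlam w)] with x hx
    rw [hx, norm_mul, Real.norm_of_nonneg (Real.sqrt_nonneg _), mul_pow, Real.sq_sqrt (hρ0 x), Real.norm_eq_abs,
      sq_abs]
  rw [e1, e2, e2, Real.sqrt_sq (norm_nonneg _), Real.sqrt_sq (norm_nonneg _)]
  exact real_inner_le_norm _ _

/-- **The transport term has no flat energy**: for `U = (u, G) ∈ H¹(μ_λ)` and a bounded velocity
field `v` which is weakly divergence-free (`∫ ⟪v, ∇h⟫ = 0` for `h ∈ C¹_c`),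
`⟪u v, (ρU)₂⟫_{L²(μ)} = ∫ ⟪v, ∇w⟫ w dx = 0` for `w = ρ_λ u` (on graphs `h = ρ²ψ²/2`; both sides are
continuous on `H`). [folklore] -/
theorem inner_fieldMulL_weightMul_snd_eq_zero
    (hdiv : ∀ h : EuclideanSpace ℝ (Fin 2) → ℝ, ContDiff ℝ 1 h → HasCompactSupport h →
      ∫ x, ⟪v x, gradient h x⟫ = 0)
    {U : WithLp 2 (Lp ℝ 2 (gaussLamMeasure lam) × Lp (EuclideanSpace ℝ (Fin 2)) 2 (gaussLamMeasure lam))}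
    (hU : U ∈ gaussLamFormDomain lam) :
    ⟪fieldMulL hvm hv U.fst, (memLp_weightMul_snd hlam U.fst U.snd).toLp _⟫ = 0 := by
  -- continuity of both factors
  have hfst := WithLp.continuous_fst 2 (Lp ℝ 2 (gaussLamMeasure lam))
    (Lp (EuclideanSpace ℝ (Fin 2)) 2 (gaussLamMeasure lam))
  have hsnd := WithLp.continuous_snd 2 (Lp ℝ 2 (gaussLamMeasure lam))
    (Lp (EuclideanSpace ℝ (Fin 2)) 2 (gaussLamMeasure lam))
  have hsplit : ∀ W : WithLp 2 (Lp ℝ 2 (gaussLamMeasure lam) × Lp (EuclideanSpace ℝ (Fin 2)) 2 (gaussLamMeasure lam)),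
      (memLp_weightMul_snd hlam W.fst W.snd).toLp _ =
        (memLp_weight_smul_snd hlam W.snd).toLp _ - (memLp_fst_smul_weight_drift hlam W.fst).toLp _ := fun W =>
    MemLp.toLp_sub _ _
  refine gaussLamFormDomain_induction lam (P := fun W =>
      ⟪fieldMulL hvm hv W.fst, (memLp_weightMul_snd hlam W.fst W.snd).toLp _⟫ = 0) ?_ ?_ hU
  · simp_rw [hsplit]
    refine isClosed_eq ?_ continuous_const
    exact ((fieldMulL hvm hv).continuous.comp hfst).inner
      (((continuous_weight_smul_snd hlam).comp hsnd).sub ((continuous_fst_smul_weight_drift hlam).comp hfst))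
  · intro ψ
    set ρ : EuclideanSpace ℝ (Fin 2) → ℝ := fun x =>
      Real.exp (-((1 + lam) / 4 * x 0 ^ 2 + (1 - lam) / 4 * x 1 ^ 2)) with hρ
    set bv : EuclideanSpace ℝ (Fin 2) → EuclideanSpace ℝ (Fin 2) := fun x =>
      toLp 2 ![(1 + lam) / 2 * x 0, (1 - lam) / 2 * x 1] with hbv
    set φ : EuclideanSpace ℝ (Fin 2) → ℝ := (ψ : EuclideanSpace ℝ (Fin 2) → ℝ) with hφ
    have hψc := planarTestFunctions.contDiff ψ
    have hψs := planarTestFunctions.hasCompactSupport ψ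
    have hψd : Differentiable ℝ φ := hψc.differentiable (by simp)
    -- the test function `h = ρ² ψ² / 2 = ρ · (ρ ψ²/2)` and its gradient
    set g : EuclideanSpace ℝ (Fin 2) → ℝ := fun x => ρ x * (φ x ^ 2 / 2) with hg
    set h : EuclideanSpace ℝ (Fin 2) → ℝ := fun x => ρ x * g x with hh
    have hsq : ∀ x, gradient (fun y => φ y ^ 2 / 2) x = φ x • gradient φ x := by
      intro x
      have := gradient_comp_eq_deriv_smul (f := fun s : ℝ => s ^ 2 / 2) (ψ := φ) (x := x)
        (by fun_prop) (hψd x)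
      rw [this]
      congr 1
      have hd : deriv (fun s : ℝ => s ^ 2 / 2) (φ x) = φ x := by
        have := ((hasDerivAt_pow 2 (φ x)).div_const 2).deriv
        rw [this]; ring
      exact hd
    have hsqd : Differentiable ℝ fun y => φ y ^ 2 / 2 := by fun_prop
    have hgd : Differentiable ℝ g :=
      ((contDiff_exp_neg_quadraticLam lam (n := 1)).differentiable one_ne_zero).mul hsqd
    have hgrad_g : ∀ x, gradient g x = ρ x • (φ x • gradient φ x - (φ x ^ 2 / 2) • bv x) := by
      intro x
      rw [hg, gradient_weight_mul hsqd, hsq]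
    have hgrad_h : ∀ x, gradient h x = ρ x ^ 2 • (φ x • gradient φ x - φ x ^ 2 • bv x) := by
      intro x
      rw [hh, gradient_weight_mul hgd, hgrad_g]
      ext i
      simp only [hg, PiLp.sub_apply, PiLp.smul_apply, smul_eq_mul]
      ring
    have hhC : ContDiff ℝ 1 h := ((contDiff_exp_neg_quadraticLam lam).mul
      ((contDiff_exp_neg_quadraticLam lam).mul ((hψc.pow 2).div_const 2))).of_le (by simp)
    have hhs : HasCompactSupport h :=
      hψs.mono (Function.support_subset_iff'.2 fun x hx => by
        rw [Function.notMem_support] at hx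
        simp only [hh, hg, hφ] at hx ⊢
        rw [hx]
        ring)
    have h0 := hdiv h hhC hhs
    -- identify with the inner product on the graph
    rw [inner_fieldMulL, integral_gaussLamMeasure, ← h0]
    refine integral_congr_ae ((ae_gaussLamMeasure_iff lam).1 ?_)
    filter_upwards [MemLp.coeFn_toLp (memLp_planarTestFunction lam ψ),
      weightMul_snd_ae hlam (gaussLamGraph lam ψ).fst (gaussLamGraph lam ψ).snd,
      MemLp.coeFn_toLp (memLp_gradient_planarTestFunction lam ψ)] with x h1 h2 h3
    rw [h2, gaussLamGraph_snd, h3, gaussLamGraph_fst, h1, hgrad_h]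
    simp only [inner_smul_right, inner_sub_right, hρ, hbv, hφ]
    ring

/-- **The flat energy inequality for the resolvent** (transport-free): for the solution
`U = (u, G)` of `a_κ(U, ·) = κ⟪ũ, ·⟫` with a weakly divergence-free `v`, testing with `Φ = ρU`
gives `κ‖w‖₂² + ‖∇w‖₂² − ½‖w‖₂² = κ ∫ w̃ w ≤ κ ‖w̃‖₂ ‖w‖₂` (`w = ρu`, `w̃ = ρũ`), i.e. with
`X = ⟪u,(ρU)₁⟫`, `X̃ = ⟪ũ,(ρŨ)₁⟫`, `D = ∫ ρ‖G − ub‖² dμ_λ`: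
`(κ − ½) X + D ≤ κ √X̃ √X`. [folklore] -/
theorem flatEnergy_driftSolve {κ : ℝ} (hκ : V ^ 2 / 2 + 1 / 2 ≤ κ)
    (hdiv : ∀ h : EuclideanSpace ℝ (Fin 2) → ℝ, ContDiff ℝ 1 h → HasCompactSupport h →
      ∫ x, ⟪v x, gradient h x⟫ = 0)
    (ut : Lp ℝ 2 (gaussLamMeasure lam)) :
    (κ - 1 / 2) * ⟪((driftSolve lam hvm hv hκ ut : gaussLamFormDomain lam) : WithLp 2 (Lp ℝ 2 (gaussLamMeasure lam) ×
        Lp (EuclideanSpace ℝ (Fin 2)) 2 (gaussLamMeasure lam))).fst,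
        (memLp_weight_mul_fst hlam ((driftSolve lam hvm hv hκ ut : gaussLamFormDomain lam) : WithLp 2 (Lp ℝ 2 (gaussLamMeasure lam) ×
          Lp (EuclideanSpace ℝ (Fin 2)) 2 (gaussLamMeasure lam))).fst).toLp _⟫ +
      ∫ x, Real.exp (-((1 + lam) / 4 * x 0 ^ 2 + (1 - lam) / 4 * x 1 ^ 2)) *
          ‖(((driftSolve lam hvm hv hκ ut : gaussLamFormDomain lam) : WithLp 2 (Lp ℝ 2 (gaussLamMeasure lam) ×
              Lp (EuclideanSpace ℝ (Fin 2)) 2 (gaussLamMeasure lam))).snd : EuclideanSpace ℝ (Fin 2) → EuclideanSpace ℝ (Fin 2)) x -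
            (((driftSolve lam hvm hv hκ ut : gaussLamFormDomain lam) : WithLp 2 (Lp ℝ 2 (gaussLamMeasure lam) ×
              Lp (EuclideanSpace ℝ (Fin 2)) 2 (gaussLamMeasure lam))).fst : EuclideanSpace ℝ (Fin 2) → ℝ) x •
              (toLp 2 ![(1 + lam) / 2 * x 0, (1 - lam) / 2 * x 1] : EuclideanSpace ℝ (Fin 2))‖ ^ 2
          ∂gaussLamMeasure lam ≤
      κ * (Real.sqrt ⟪ut, (memLp_weight_mul_fst hlam ut).toLp _⟫ *
        Real.sqrt ⟪((driftSolve lam hvm hv hκ ut : gaussLamFormDomain lam) : WithLp 2 (Lp ℝ 2 (gaussLamMeasure lam) ×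
          Lp (EuclideanSpace ℝ (Fin 2)) 2 (gaussLamMeasure lam))).fst,
          (memLp_weight_mul_fst hlam ((driftSolve lam hvm hv hκ ut : gaussLamFormDomain lam) : WithLp 2 (Lp ℝ 2 (gaussLamMeasure lam) ×
            Lp (EuclideanSpace ℝ (Fin 2)) 2 (gaussLamMeasure lam))).fst).toLp _⟫) := by
  have hκ0 : 0 ≤ κ := by nlinarith [sq_nonneg V]
  set U : gaussLamFormDomain lam := driftSolve lam hvm hv hκ ut with hUdef
  set Uv : WithLp 2 (Lp ℝ 2 (gaussLamMeasure lam) × Lp (EuclideanSpace ℝ (Fin 2)) 2 (gaussLamMeasure lam)) :=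
    ((U : gaussLamFormDomain lam) : WithLp 2 (Lp ℝ 2 (gaussLamMeasure lam) × Lp (EuclideanSpace ℝ (Fin 2)) 2 (gaussLamMeasure lam)))
    with hUv
  -- the test function `Φ = ρU ∈ H`
  set Φ : gaussLamFormDomain lam := ⟨toLp 2 ((memLp_weight_mul_fst hlam Uv.fst).toLp _,
    (memLp_weightMul_snd hlam Uv.fst Uv.snd).toLp _), weightMul_mem_gaussLamFormDomain hlam U.2⟩ with hΦ
  have hΦfst : ((Φ : gaussLamFormDomain lam) : WithLp 2 (Lp ℝ 2 (gaussLamMeasure lam) ×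
      Lp (EuclideanSpace ℝ (Fin 2)) 2 (gaussLamMeasure lam))).fst = (memLp_weight_mul_fst hlam Uv.fst).toLp _ := rfl
  have hΦsnd : ((Φ : gaussLamFormDomain lam) : WithLp 2 (Lp ℝ 2 (gaussLamMeasure lam) ×
      Lp (EuclideanSpace ℝ (Fin 2)) 2 (gaussLamMeasure lam))).snd = (memLp_weightMul_snd hlam Uv.fst Uv.snd).toLp _ := rfl
  have hspec := driftSolve_spec lam hvm hv hκ ut Φ
  rw [driftForm_apply, hΦfst, hΦsnd, ← hUdef] at hspec
  change κ * ⟪Uv.fst, (memLp_weight_mul_fst hlam Uv.fst).toLp _⟫ +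
      ⟪Uv.snd, (memLp_weightMul_snd hlam Uv.fst Uv.snd).toLp _⟫ -
      ⟪fieldMulL hvm hv Uv.fst, (memLp_weightMul_snd hlam Uv.fst Uv.snd).toLp _⟫ =
      κ * ⟪ut, (memLp_weight_mul_fst hlam Uv.fst).toLp _⟫ at hspec
  rw [inner_snd_weightMul_snd_eq hlam U.2, inner_fieldMulL_weightMul_snd_eq_zero hlam hvm hv hdiv U.2, sub_zero] at hspec
  have hCS := inner_weight_mul_fst_le_sqrt hlam ut Uv.fst
  change (κ - 1 / 2) * ⟪Uv.fst, (memLp_weight_mul_fst hlam Uv.fst).toLp _⟫ + _ ≤ _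
  nlinarith [hCS, hspec]

omit hlam hvm hv in
/-- **The flat `L²` bound is preserved**: with `X = ‖w‖₂²`, `X̃ = ‖w̃‖₂²`, `m = ‖w‖₁` the flat
norms of `w = ρu`, `w̃ = ρũ`: if `X̃ ≤ R₀²` and `C m²/2 ≤ R₀²` with `X² ≤ C m² D` (Nash) and
`(κ − ½)X + D ≤ κ √X̃ √X` (flat energy), then `X ≤ R₀²` — otherwise `X̃ ≤ X` would give `D ≤ X/2`
and Nash `X ≤ C m²/2 ≤ R₀²`. Pure real-variable lemma. [folklore] -/
theorem flatBound_preserved {κ X Xt D C m R₀ : ℝ} (hκ : 1 / 2 ≤ κ) (hX0 : 0 ≤ X) (hC0 : 0 ≤ C)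
    (hnash : X ^ 2 ≤ C * m ^ 2 * D) (henergy : (κ - 1 / 2) * X + D ≤ κ * (Real.sqrt Xt * Real.sqrt X))
    (hXt : Xt ≤ R₀ ^ 2) (hR : C * m ^ 2 / 2 ≤ R₀ ^ 2) : X ≤ R₀ ^ 2 := by
  by_contra hcon
  push Not at hcon
  have hXtX : Xt ≤ X := by linarith
  have hsqrt : Real.sqrt Xt * Real.sqrt X ≤ X := by
    calc Real.sqrt Xt * Real.sqrt X ≤ Real.sqrt X * Real.sqrt X :=
          mul_le_mul_of_nonneg_right (Real.sqrt_le_sqrt hXtX) (Real.sqrt_nonneg _)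
      _ = X := Real.mul_self_sqrt hX0
  have hκ0 : 0 ≤ κ := by linarith
  have hD : D ≤ X / 2 := by nlinarith [mul_le_mul_of_nonneg_left hsqrt hκ0]
  have hXpos : 0 < X := by nlinarith [sq_nonneg R₀]
  have h1 : X ^ 2 ≤ C * m ^ 2 * (X / 2) := hnash.trans (mul_le_mul_of_nonneg_left hD (by positivity))
  have h2 : X ≤ C * m ^ 2 / 2 := by nlinarith
  linarith

omit hlam hvm hv in
/-- **The flat gradient bound**: under the flat energy inequality with `X, X̃ ≤ R₀²` and `κ ≥ ½`,
`D ≤ κ R₀²`. [folklore] -/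
theorem flatGradBound {κ X Xt D R₀ : ℝ} (hκ : 1 / 2 ≤ κ) (hX0 : 0 ≤ X)
    (henergy : (κ - 1 / 2) * X + D ≤ κ * (Real.sqrt Xt * Real.sqrt X))
    (hXt : Xt ≤ R₀ ^ 2) (hX : X ≤ R₀ ^ 2) (hR0 : 0 ≤ R₀) : D ≤ κ * R₀ ^ 2 := by
  have h1 : Real.sqrt Xt ≤ R₀ := by rw [← Real.sqrt_sq hR0]; exact Real.sqrt_le_sqrt hXt
  have h2 : Real.sqrt X ≤ R₀ := by rw [← Real.sqrt_sq hR0]; exact Real.sqrt_le_sqrt hX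
  have h3 : Real.sqrt Xt * Real.sqrt X ≤ R₀ * R₀ :=
    mul_le_mul h1 h2 (Real.sqrt_nonneg _) hR0
  have hκ0 : 0 ≤ κ := by linarith
  nlinarith [mul_le_mul_of_nonneg_left h3 hκ0, mul_nonneg (by linarith : (0:ℝ) ≤ κ - 1 / 2) hX0]

omit hlam in
/-- **The weighted energy inequality for the resolvent**: testing with `Φ = U` and using
`|⟪uv, G⟫| ≤ V‖u‖‖G‖`: with `Y = ‖u‖²_{L²(μ)}`, `Γ = ‖G‖²`, `Ỹ = ‖ũ‖²`,
`(κ − V²) Y + Γ ≤ κ Ỹ`. [folklore] -/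
theorem weightedEnergy_driftSolve {κ : ℝ} (hκ : V ^ 2 / 2 + 1 / 2 ≤ κ) (ut : Lp ℝ 2 (gaussLamMeasure lam)) :
    (κ - V ^ 2) * ‖((driftSolve lam hvm hv hκ ut : gaussLamFormDomain lam) : WithLp 2 (Lp ℝ 2 (gaussLamMeasure lam) ×
        Lp (EuclideanSpace ℝ (Fin 2)) 2 (gaussLamMeasure lam))).fst‖ ^ 2 +
      ‖((driftSolve lam hvm hv hκ ut : gaussLamFormDomain lam) : WithLp 2 (Lp ℝ 2 (gaussLamMeasure lam) ×
        Lp (EuclideanSpace ℝ (Fin 2)) 2 (gaussLamMeasure lam))).snd‖ ^ 2 ≤ κ * ‖ut‖ ^ 2 := by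
  have hκ0 : 0 ≤ κ := by nlinarith [sq_nonneg V]
  set U : gaussLamFormDomain lam := driftSolve lam hvm hv hκ ut with hUdef
  set u := ((U : gaussLamFormDomain lam) : WithLp 2 (Lp ℝ 2 (gaussLamMeasure lam) × Lp (EuclideanSpace ℝ (Fin 2)) 2 (gaussLamMeasure lam))).fst
    with hu
  set G := ((U : gaussLamFormDomain lam) : WithLp 2 (Lp ℝ 2 (gaussLamMeasure lam) × Lp (EuclideanSpace ℝ (Fin 2)) 2 (gaussLamMeasure lam))).snd
    with hG
  have hspec := driftSolve_spec lam hvm hv hκ ut U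
  rw [driftForm_apply, ← hUdef, ← hu, ← hG, real_inner_self_eq_norm_sq, real_inner_self_eq_norm_sq] at hspec
  have hT : ⟪fieldMulL hvm hv u, G⟫ ≤ V * ‖u‖ * ‖G‖ :=
    (le_abs_self _).trans ((abs_real_inner_le_norm _ _).trans
      (mul_le_mul_of_nonneg_right (norm_fieldMulL_le hvm hv u) (norm_nonneg _)))
  have hR : κ * ⟪ut, u⟫ ≤ κ * (‖ut‖ * ‖u‖) :=
    mul_le_mul_of_nonneg_left ((le_abs_self _).trans (abs_real_inner_le_norm _ _)) hκ0
  have hV0 := fieldBound_nonneg hv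
  nlinarith [sq_nonneg (V * ‖u‖ - ‖G‖), sq_nonneg (‖ut‖ - ‖u‖), norm_nonneg u, norm_nonneg G, norm_nonneg ut,
    mul_nonneg hκ0 (sq_nonneg (‖ut‖ - ‖u‖))]

omit hvm hv in
/-- **Confinement**: for `U = (u, G) ∈ H¹(μ_λ)` and every `s > 0`,
`‖u‖²_{L²(μ)} ≤ s⁻¹ (16/(1−λ)² ‖G‖² + 8/(1−λ) ‖u‖²) + e^{s/2} ‖ρu‖²_{L²(dx)}`
(pointwise `u² ≤ (|x|²/s) u² + e^{s/2} ρ u²` — if `|x|² < s` then `ρ ≥ e^{−|x|²/2} ≥ e^{−s/2}` —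
integrated against `μ_λ`, and the moment bound `integral_norm_sq_mul_sq_le_of_mem_gaussLamFormDomain`).
[folklore] -/
theorem norm_sq_fst_le_confinement {U : WithLp 2 (Lp ℝ 2 (gaussLamMeasure lam) × Lp (EuclideanSpace ℝ (Fin 2)) 2 (gaussLamMeasure lam))}
    (hU : U ∈ gaussLamFormDomain lam) {s : ℝ} (hs : 0 < s) :
    ‖U.fst‖ ^ 2 ≤ s⁻¹ * (16 / (1 - lam) ^ 2 * ‖U.snd‖ ^ 2 + 8 / (1 - lam) * ‖U.fst‖ ^ 2) +
      Real.exp (s / 2) * ⟪U.fst, (memLp_weight_mul_fst hlam U.fst).toLp _⟫ := by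
  obtain ⟨hmi, hmle⟩ := integral_norm_sq_mul_sq_le_of_mem_gaussLamFormDomain hlam hU
  set u : EuclideanSpace ℝ (Fin 2) → ℝ := (U.fst : EuclideanSpace ℝ (Fin 2) → ℝ) with hu
  set ρ : EuclideanSpace ℝ (Fin 2) → ℝ := fun x =>
    Real.exp (-((1 + lam) / 4 * x 0 ^ 2 + (1 - lam) / 4 * x 1 ^ 2)) with hρ
  have hl0 := hlam.1
  have hl1 := hlam.2
  -- the three integrals against `μ_λ`
  have hY : ‖U.fst‖ ^ 2 = ∫ x, u x ^ 2 ∂gaussLamMeasure lam := by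
    rw [norm_sq_Lp_two_eq_integral_norm_sq]
    exact integral_congr_ae (Eventually.of_forall fun x => by dsimp only; rw [Real.norm_eq_abs, sq_abs])
  have hM : ∫ x, ‖x‖ ^ 2 * u x ^ 2 ∂gaussLamMeasure lam = ∫ x, ‖x‖ ^ 2 * u x ^ 2 * ρ x := by
    rw [integral_gaussLamMeasure]
  have hMi : Integrable (fun x => ‖x‖ ^ 2 * u x ^ 2) (gaussLamMeasure lam) := by
    rw [integrable_gaussLamMeasure_iff]; exact hmi
  have hX : ⟪U.fst, (memLp_weight_mul_fst hlam U.fst).toLp _⟫ = ∫ x, ρ x * u x ^ 2 ∂gaussLamMeasure lam :=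
    inner_fst_weightMul_fst_eq hlam U.fst
  have hXi : Integrable (fun x => ρ x * u x ^ 2) (gaussLamMeasure lam) := by
    have h := L2.integrable_inner (𝕜 := ℝ) U.fst ((memLp_weight_mul_fst hlam U.fst).toLp _)
    refine h.congr ?_
    filter_upwards [MemLp.coeFn_toLp (memLp_weight_mul_fst hlam U.fst)] with x hx
    rw [hx]
    simp only [RCLike.inner_apply, conj_trivial, hρ, hu]
    ring
  have hYi : Integrable (fun x => u x ^ 2) (gaussLamMeasure lam) :=
    (memLp_two_iff_integrable_sq (Lp.aestronglyMeasurable U.fst)).1 (Lp.memLp U.fst)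
  -- pointwise confinement
  have hpt : ∀ x : EuclideanSpace ℝ (Fin 2), u x ^ 2 ≤ s⁻¹ * (‖x‖ ^ 2 * u x ^ 2) + Real.exp (s / 2) * (ρ x * u x ^ 2) := by
    intro x
    have hu2 : 0 ≤ u x ^ 2 := sq_nonneg _
    by_cases hx : s ≤ ‖x‖ ^ 2
    · have h1 : u x ^ 2 ≤ s⁻¹ * (‖x‖ ^ 2 * u x ^ 2) := by
        rw [← mul_assoc]
        have : 1 ≤ s⁻¹ * ‖x‖ ^ 2 := by rw [le_inv_mul_iff₀ hs]; simpa using hx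
        nlinarith
      have h2 : 0 ≤ Real.exp (s / 2) * (ρ x * u x ^ 2) := by positivity
      linarith
    · push Not at hx
      have hρx : Real.exp (-(s / 2)) ≤ ρ x := by
        rw [hρ]
        simp only [Real.exp_le_exp, neg_le_neg_iff]
        have h2 : (1 + lam) / 4 * x 0 ^ 2 + (1 - lam) / 4 * x 1 ^ 2 ≤ ‖x‖ ^ 2 / 2 := by
          rw [EuclideanSpace.norm_sq_eq, Fin.sum_univ_two, Real.norm_eq_abs, Real.norm_eq_abs, sq_abs, sq_abs]
          nlinarith [sq_nonneg (x 0), sq_nonneg (x 1)]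
        linarith
      have h1 : u x ^ 2 ≤ Real.exp (s / 2) * (ρ x * u x ^ 2) := by
        have : 1 ≤ Real.exp (s / 2) * ρ x := by
          calc (1 : ℝ) = Real.exp (s / 2) * Real.exp (-(s / 2)) := by rw [← Real.exp_add, add_neg_cancel, Real.exp_zero]
            _ ≤ Real.exp (s / 2) * ρ x := mul_le_mul_of_nonneg_left hρx (Real.exp_pos _).le
        nlinarith
      have h2 : 0 ≤ s⁻¹ * (‖x‖ ^ 2 * u x ^ 2) := by positivity
      linarith
  have hgi : Integrable (fun x : EuclideanSpace ℝ (Fin 2) => s⁻¹ * (‖x‖ ^ 2 * u x ^ 2) + Real.exp (s / 2) * (ρ x * u x ^ 2))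
      (gaussLamMeasure lam) := (hMi.const_mul s⁻¹).add (hXi.const_mul (Real.exp (s / 2)))
  have hint := integral_mono hYi hgi hpt
  rw [integral_add (hMi.const_mul s⁻¹) (hXi.const_mul (Real.exp (s / 2))), integral_const_mul, integral_const_mul] at hint
  have hmom : ∫ x, ‖x‖ ^ 2 * u x ^ 2 ∂gaussLamMeasure lam ≤
      16 / (1 - lam) ^ 2 * ‖U.snd‖ ^ 2 + 8 / (1 - lam) * ‖U.fst‖ ^ 2 := by rw [hM]; exact hmle
  rw [← hY, ← hX] at hint
  have h2 := mul_le_mul_of_nonneg_left hmom (inv_nonneg.2 hs.le)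
  linarith

omit hlam hvm hv in
/-- Bookkeeping for the weighted bound: from the weighted energy inequality
`(κ − V²)Y + Γ ≤ κ Ỹ`, the confinement `Y ≤ s⁻¹(C_a Γ + C_b Y) + e X` with `s = 4 C_a κ + 2 C_b`,
`κ ≥ V² + 1`, one gets `Y ≤ ¼ Ỹ + 2 e X` and `Γ ≤ κ Ỹ`. [folklore] -/
theorem weighted_bookkeeping {κ V Y Γ X Yt Ca Cb e : ℝ} (hκ' : V ^ 2 + 1 ≤ κ) (hCa0 : 0 < Ca) (hCb0 : 0 < Cb)
    (hY0 : 0 ≤ Y) (hΓ0 : 0 ≤ Γ) (hX0 : 0 ≤ X) (he0 : 0 ≤ e)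
    (hE : (κ - V ^ 2) * Y + Γ ≤ κ * Yt)
    (hC : Y ≤ (4 * Ca * κ + 2 * Cb)⁻¹ * (Ca * Γ + Cb * Y) + e * X) :
    Y ≤ 1 / 4 * Yt + 2 * e * X ∧ Γ ≤ κ * Yt := by
  have hκ1 : 1 ≤ κ := by nlinarith [sq_nonneg V]
  set s : ℝ := 4 * Ca * κ + 2 * Cb with hsdef
  have hs0 : 0 < s := by positivity
  have hΓle : Γ ≤ κ * Yt - Y := by nlinarith
  refine ⟨?_, by nlinarith⟩
  have hC' : s * Y ≤ Ca * Γ + Cb * Y + s * (e * X) := by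
    have := mul_le_mul_of_nonneg_left hC hs0.le
    rw [mul_add, ← mul_assoc, mul_inv_cancel₀ hs0.ne', one_mul] at this
    linarith
  have h1 : (s + Ca - Cb) * Y ≤ Ca * κ * Yt + s * (e * X) := by nlinarith
  have hcoef : 4 * Ca * κ ≤ s + Ca - Cb := by rw [hsdef]; nlinarith
  have hcoef0 : 0 < s + Ca - Cb := by nlinarith
  have h2 : Y ≤ (Ca * κ * Yt + s * (e * X)) / (s + Ca - Cb) := by
    rw [le_div_iff₀ hcoef0]; linarith
  have hYt0 : 0 ≤ κ * Yt := by nlinarith [mul_nonneg (by nlinarith : (0:ℝ) ≤ κ - V ^ 2) hY0]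
  have h3 : (Ca * κ * Yt) / (s + Ca - Cb) ≤ 1 / 4 * Yt := by
    rw [div_le_iff₀ hcoef0]
    have : 0 ≤ Yt := by nlinarith
    nlinarith
  have h4 : (s * (e * X)) / (s + Ca - Cb) ≤ 2 * e * X := by
    rw [div_le_iff₀ hcoef0]
    have : s ≤ 2 * (s + Ca - Cb) := by rw [hsdef]; nlinarith
    nlinarith [mul_nonneg he0 hX0]
  calc Y ≤ (Ca * κ * Yt + s * (e * X)) / (s + Ca - Cb) := h2
    _ = (Ca * κ * Yt) / (s + Ca - Cb) + (s * (e * X)) / (s + Ca - Cb) := by rw [add_div]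
    _ ≤ 1 / 4 * Yt + 2 * e * X := add_le_add h3 h4

/-- **The weighted bound is self-improving**: with `C_a = 16/(1−λ)²`, `C_b = 8/(1−λ)`,
`κ ≥ V² + 1` and `s = 4 C_a κ + 2 C_b`, the solution satisfies
`‖u‖² ≤ ¼ ‖ũ‖² + 2 e^{s/2} ‖ρu‖²_{L²(dx)}` and `‖G‖² ≤ κ ‖ũ‖²`
(weighted energy + confinement + bookkeeping). [folklore] -/
theorem weightedBound_driftSolve {κ : ℝ} (hκ : V ^ 2 / 2 + 1 / 2 ≤ κ) (hκ' : V ^ 2 + 1 ≤ κ)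
    (ut : Lp ℝ 2 (gaussLamMeasure lam)) :
    ‖((driftSolve lam hvm hv hκ ut : gaussLamFormDomain lam) : WithLp 2 (Lp ℝ 2 (gaussLamMeasure lam) ×
        Lp (EuclideanSpace ℝ (Fin 2)) 2 (gaussLamMeasure lam))).fst‖ ^ 2 ≤
      1 / 4 * ‖ut‖ ^ 2 + 2 * Real.exp ((4 * (16 / (1 - lam) ^ 2) * κ + 2 * (8 / (1 - lam))) / 2) *
        ⟪((driftSolve lam hvm hv hκ ut : gaussLamFormDomain lam) : WithLp 2 (Lp ℝ 2 (gaussLamMeasure lam) ×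
          Lp (EuclideanSpace ℝ (Fin 2)) 2 (gaussLamMeasure lam))).fst,
          (memLp_weight_mul_fst hlam ((driftSolve lam hvm hv hκ ut : gaussLamFormDomain lam) : WithLp 2 (Lp ℝ 2 (gaussLamMeasure lam) ×
            Lp (EuclideanSpace ℝ (Fin 2)) 2 (gaussLamMeasure lam))).fst).toLp _⟫ ∧
    ‖((driftSolve lam hvm hv hκ ut : gaussLamFormDomain lam) : WithLp 2 (Lp ℝ 2 (gaussLamMeasure lam) ×
        Lp (EuclideanSpace ℝ (Fin 2)) 2 (gaussLamMeasure lam))).snd‖ ^ 2 ≤ κ * ‖ut‖ ^ 2 := by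
  have hq : 0 < 1 - lam := by linarith [hlam.2]
  have hCa0 : (0 : ℝ) < 16 / (1 - lam) ^ 2 := by positivity
  have hCb0 : (0 : ℝ) < 8 / (1 - lam) := by positivity
  have hκ1 : 1 ≤ κ := by nlinarith [sq_nonneg V]
  have hs0 : (0 : ℝ) < 4 * (16 / (1 - lam) ^ 2) * κ + 2 * (8 / (1 - lam)) := by positivity
  have hE := weightedEnergy_driftSolve hvm hv hκ ut
  have hC := norm_sq_fst_le_confinement hlam (driftSolve lam hvm hv hκ ut).2 hs0
  exact weighted_bookkeeping hκ' hCa0 hCb0 (sq_nonneg _) (sq_nonneg _) (inner_fst_weightMul_fst_nonneg hlam _)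
    (Real.exp_pos _).le hE hC

end Apriori

end Literature.Analysis.FluidPDE
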